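import Summits.HodgeConjecture.HodgeCM.PerL34.TorusOccurrence_1

/-! PORT of `HodgeCM/PerL34/TorusOccurrence.lean` (HodgeCMPerL run 82) — part 2: continuation of `Summits.HodgeConjecture.HodgeCM.PerL34.TorusOccurrence_1` (split at a top-level declaration boundary by port_pkg.py; scope re-opened below; declarations unchanged). -/

-- port_pkg: scope re-opened for this part (file-level context, then the namespace/section stack open at the cut)
set_option autoImplicit false
noncomputable section
open scoped InnerProductSpace
namespace NumberField
namespace SeesawArchTorus
open NumberField.InfinitePlace
variable (L : Type) [Field L] [NumberField L] [IsCMField L]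
/-- The pulled-back weight is a unitary character of `∏_w U(1) × U(1)` (as a monoid hom into `ℂ`). -/
def placesWeight (m₁ m₂ : InfinitePlace L → ℤ) : (InfinitePlace L → Circle × Circle) →* ℂ :=
  (weight L m₁ m₂).comp (placesEquiv L).symm.toMonoidHom

variable {L} in
/-- (Ported verbatim from the HodgeCMPerL package; no docstring in the source.) -/
theorem placesWeight_apply (m₁ m₂ : InfinitePlace L → ℤ) (f : InfinitePlace L → Circle × Circle) :
    placesWeight L m₁ m₂ f = ∏ w, (((f w).1 : Circle) : ℂ) ^ (m₁ w) * (((f w).2 : Circle) : ℂ) ^ (m₂ w) :=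
  weight_placesEquiv_symm L m₁ m₂ f

variable {L} in
/-- (Ported verbatim from the HodgeCMPerL package; no docstring in the source.) -/
theorem placesWeight_placesEquiv (m₁ m₂ : InfinitePlace L → ℤ) (t : SeesawArchTorus L) :
    placesWeight L m₁ m₂ (placesEquiv L t) = weight L m₁ m₂ t := by
  change weight L m₁ m₂ ((placesEquiv L).symm (placesEquiv L t)) = _
  rw [ContinuousMulEquiv.symm_apply_apply]

/-- (Ported verbatim from the HodgeCMPerL package; no docstring in the source.) -/
theorem norm_placesWeight (m₁ m₂ : InfinitePlace L → ℤ) (f : InfinitePlace L → Circle × Circle) :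
    ‖placesWeight L m₁ m₂ f‖ = 1 :=
  norm_weight L m₁ m₂ _

/-- (Ported verbatim from the HodgeCMPerL package; no docstring in the source.) -/
theorem continuous_placesWeight (m₁ m₂ : InfinitePlace L → ℤ) : Continuous (placesWeight L m₁ m₂) :=
  (continuous_weight L m₁ m₂).comp (placesEquiv L).symm.continuous

/-! ## §4  §2 in place coordinates: the end-state torus `T(L₀ ⊗ ℝ)` with the typed weight -/

section EndState

variable {H : Type*} [NormedAddCommGroup H] [InnerProductSpace ℂ H] [CompleteSpace H]
variable {G : Type*} [Group G]

/-- **The S4 torus dictionary on the end state, KERNEL.**  For a unitary `R : G →* (H →L[ℂ] H)` and a torus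
`torus : T(L₀ ⊗ ℝ) = SeesawArchTorus L → G` with the typed weight `weight L m₁ m₂` (prl1-g4 `AdelicTorusCompactInput`:
`Tι := SeesawArchTorus L`, `torus := jT ∘ toAdeles`, `w := weight L m₁ m₂`, so that the end state's `D.wOccurs c` is
`RepDecomp.WOccurs C.R D.torus (weight L m₁ m₂) c` by `rfl`): a non-zero vector of `σ̂_c = closure (isotypic R c)` on which
every `f ∈ ∏_w U(1) × U(1)` acts, through `torus ((placesEquiv L)⁻¹ f)`, by `∏_w (f w)₁^{m₁ w} (f w)₂^{m₂ w}` makes `w` OCCUR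
in the class `c`.  This is the field `FockArchBridge.wOccurs_of_eigenvector` for a chart with
`Tg := InfinitePlace L → Circle × Circle`, `ιT := torus ∘ (placesEquiv L).symm`, `w := placesWeight L m₁ m₂`. -/
theorem wOccurs_of_placesEigenvector {R : G →* (H →L[ℂ] H)} (hU : HodgeCM.PerL34.Spectral.IsUnitaryRep R)
    (torus : SeesawArchTorus L → G) (m₁ m₂ : InfinitePlace L → ℤ) (c : HodgeCM.RepDecomp.IsoClass R)
    (h : ∃ y ∈ (HodgeCM.RepDecomp.isotypic R c).topologicalClosure, y ≠ 0 ∧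
      ∀ f : InfinitePlace L → Circle × Circle,
        R (torus ((placesEquiv L).symm f)) y = placesWeight L m₁ m₂ f • y) :
    HodgeCM.RepDecomp.WOccurs R torus (weight L m₁ m₂) c := by
  obtain ⟨y, hy, hy0, hyf⟩ := h
  refine HodgeCM.RepDecomp.WOccurs.of_mem_closure_isotypic torus (weight L m₁ m₂) hU hy hy0
    (HodgeCM.RepDecomp.mem_Ew_of_forall_comp torus (weight L m₁ m₂) (placesEquiv L).symm
      (placesEquiv L).symm.surjective fun f => ?_)
  rw [hyf f, ← placesWeight_placesEquiv, ContinuousMulEquiv.apply_symm_apply]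

end EndState

end SeesawArchTorus

end NumberField

end
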